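import Literature.NumberTheory.Automorphic.IdeleClassGaloisRep
import Mathlib.Algebra.Homology.ShortComplex.ShortExact
import HarnessLib

/-!
# The idèle group as an integral Galois representation and the short exact sequence
# `0 → Eˣ → J_E → C_E → 0` in `Rep ℤ Gal(E/F)` (Tate, Cassels–Fröhlich Ch. VII §§7–8; Neukirch, *Bonn Lectures* III §2)

Topic `NumberTheory/Automorphic` (ideles, idele classes); namespace `Literature.NumberTheory.Automorphic.IdeleClassGroup`.
Definitions with bodies (the representation `ideleRep`, the two morphisms, the short complex) and theorems; NO named
fact, no instance, no notation.

The cohomological construction of the global fundamental class (Tate, Cassels–Fröhlich VII §§7–11) runs on the long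
exact cohomology sequence of the `Gal(E/F)`-module sequence `0 → Eˣ → J_E → C_E → 0` ("`1 → L* → J_L → C_L → 1`",
VII §8), together with `H¹(G, C_L) = 0` (tree: `isZero_H1_galoisRep`), Hilbert 90 (Mathlib), and the local
decomposition of `Hq(G, J_L)` (§7.3, not here).  This file packages that sequence on Mathlib's `Rep ℤ G` /
`ShortComplex`, so that the tree's finite-group cohomology engine (`Literature/Algebra/Homology`, Mathlib
`groupCohomology.δ`, long exact sequences) applies to it:

* `ideleRep F E : Rep ℤ (E ≃ₐ[F] E)` — `J_E = 𝕀_E` written additively (`Rep.ofMulDistribMulAction` of the tree's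
  Galois action `instMulDistribMulActionIdeleGroup`), with `ideleRep_ρ_apply`; its invariants are the idèles of `F`
  (`mem_invariants_ideleRep_iff`, Galois descent `AdeleRing.mem_range_ideleBaseChange_iff`, Neukirch III (2.5)).
* `principalRepHom F E : Rep.ofAlgebraAutOnUnits F E ⟶ ideleRep F E` (`Eˣ → J_E`, `IdeleHerbrand.principal`) and
  `classRepHom F E : ideleRep F E ⟶ galoisRep F E` (`J_E → C_E`, the quotient map).
* **`ideleClassShortComplex F E`** and **`ideleClassShortComplex_shortExact`**: `0 → Eˣ → J_E → C_E → 0` is a short exact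
  sequence in `Rep ℤ Gal(E/F)`.

## References

* J. W. S. Cassels, A. Fröhlich (eds.), *Algebraic Number Theory* (1967), Ch. VII (J. Tate) §7–§8 (the `G`-modules
  `J_L`, `C_L`; Prop. 8.1). [CasselsFrohlichANT1967]
* J. Neukirch, *Class Field Theory — The Bonn Lectures* (2013), Part III §2 (2.5)–(2.7). [Neukirch2013]
-/

noncomputable section

open NumberField CategoryTheory CategoryTheory.Limits groupCohomology
open scoped NumberField

namespace Literature.NumberTheory.Automorphic

namespace IdeleClassGroup

open Literature.NumberTheory.GaloisRepresentations

variable (F E : Type) [Field F] [Field E] [Algebra F E] [NumberField E]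

/-! ## §1. `J_E` as an object of `Rep ℤ Gal(E/F)` -/

/-- **The idèle group `J_E = 𝕀_E` as an object of `Rep ℤ Gal(E/F)`** (additively written; `σ ∈ Aut(E/F)` acting
through the tree's action on `𝔸_Eˣ`, `instMulDistribMulActionIdeleGroup`, "`(σx)_{σw} = σ_w x_w`").
[cite: CasselsFrohlichANT1967, Ch. VII §7 (the `G`-module `J_L`)] -/
def ideleRep : Rep.{0} ℤ (E ≃ₐ[F] E) := Rep.ofMulDistribMulAction (E ≃ₐ[F] E) (ideleGroup E)

/-- The representation unfolds to the Galois action on idèles. [cite: CasselsFrohlichANT1967, Ch. VII §7] -/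
theorem ideleRep_ρ_apply (g : E ≃ₐ[F] E) (x : Additive (ideleGroup E)) :
    (ideleRep F E).ρ g x = Additive.ofMul (g • Additive.toMul x) := rfl

/-- **`(J_E)^{Gal(E/F)} = J_F`** (Galois descent for idèles, Neukirch III (2.5), Cassels–Fröhlich VII Prop. 8.1): a
vector of `ideleRep F E` is invariant iff the underlying idèle is the base change of an idèle of `F`.
[cite: Neukirch2013, Part III §2 (2.5)] -/
theorem mem_invariants_ideleRep_iff [NumberField F] [IsGalois F E] (x : Additive (ideleGroup E)) :
    x ∈ (ideleRep F E).ρ.invariants ↔ Additive.toMul x ∈ Set.range (AdeleRing.ideleBaseChange F E) := by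
  rw [AdeleRing.mem_range_ideleBaseChange_iff]
  change (∀ g : E ≃ₐ[F] E, (ideleRep F E).ρ g x = x) ↔ _
  refine forall_congr' fun g => ⟨fun h => ?_, fun h => ?_⟩
  · exact congrArg Additive.toMul h
  · exact congrArg Additive.ofMul h

/-! ## §2. The morphisms `Eˣ → J_E → C_E` -/

/-- **The principal idèles `Eˣ → J_E` as a morphism of `Rep ℤ Gal(E/F)`** (`IdeleHerbrand.principal`, equivariant by
`IdeleHerbrand.principal_smul`). [cite: CasselsFrohlichANT1967, Ch. VII §8 (the sequence `1 → L* → J_L → C_L → 1`)] -/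
def principalRepHom : Rep.ofAlgebraAutOnUnits F E ⟶ ideleRep F E :=
  Rep.ofHom ⟨(MonoidHom.toAdditive (IdeleHerbrand.principal E)).toIntLinearMap, fun g =>
    LinearMap.ext fun x =>
      congrArg Additive.ofMul (IdeleHerbrand.principal_smul g (Additive.toMul x))⟩

/-- Unfolding: `principalRepHom (k) = (k)_𝔸`. [cite: CasselsFrohlichANT1967, Ch. VII §8] -/
theorem principalRepHom_apply (x : (Rep.ofAlgebraAutOnUnits F E).V) :
    (principalRepHom F E).hom x = Additive.ofMul (IdeleHerbrand.principal E (Additive.toMul x)) := rfl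

/-- **The class map `J_E → C_E` as a morphism of `Rep ℤ Gal(E/F)`** (the quotient map; equivariant by definition
of `classGalAct`). [cite: CasselsFrohlichANT1967, Ch. VII §8 (the sequence `1 → L* → J_L → C_L → 1`)] -/
def classRepHom : ideleRep F E ⟶ galoisRep F E :=
  letI : AddCommGroup (Additive (IdeleClassGroup E)) := Additive.addCommGroup
  letI : Module ℤ (Additive (IdeleClassGroup E)) := AddCommGroup.toIntModule _
  Rep.ofHom ⟨(MonoidHom.toAdditive (QuotientGroup.mk' (principalIdeles E))).toIntLinearMap, fun _ =>
    LinearMap.ext fun _ => rfl⟩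

/-- Unfolding: `classRepHom x = [x]`. [cite: CasselsFrohlichANT1967, Ch. VII §8] -/
theorem classRepHom_apply (x : Additive (ideleGroup E)) :
    (classRepHom F E).hom x = Additive.ofMul ((Additive.toMul x : ideleGroup E) : IdeleClassGroup E) := rfl

/-! ## §3. The short exact sequence `0 → Eˣ → J_E → C_E → 0` -/

universe u in
/-- A short complex of representations whose maps are injective / exact / surjective on elements is short exact
(exactness is reflected by the faithful forgetful functor to `k`-modules). [folklore] -/
private theorem shortExact_of_apply {k G : Type u} [CommRing k] [Group G] (S : ShortComplex (Rep.{u} k G))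
    (hinj : Function.Injective S.f.hom) (hsurj : Function.Surjective S.g.hom)
    (hex : ∀ x, S.g.hom x = 0 → ∃ y, S.f.hom y = x) : S.ShortExact where
  exact := by
    apply (forget₂ (Rep k G) (ModuleCat k)).reflects_exact_of_faithful
    rw [ShortComplex.moduleCat_exact_iff]
    exact hex
  mono_f := (Rep.mono_iff_injective _).2 hinj
  epi_g := (Rep.epi_iff_surjective _).2 hsurj


/-- **`0 → Eˣ → J_E → C_E → 0` as a short complex in `Rep ℤ Gal(E/F)`** (the class of a principal idèle is
trivial). [cite: CasselsFrohlichANT1967, Ch. VII §8] -/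
def ideleClassShortComplex : ShortComplex (Rep.{0} ℤ (E ≃ₐ[F] E)) :=
  ShortComplex.mk (principalRepHom F E) (classRepHom F E) (by
    refine Rep.hom_ext (Representation.IntertwiningMap.ext (LinearMap.ext fun x => ?_))
    change Additive.ofMul (((IdeleHerbrand.principal E (Additive.toMul x) : ideleGroup E) : IdeleClassGroup E)) =
      Additive.ofMul 1
    exact congrArg Additive.ofMul ((QuotientGroup.eq_one_iff _).mpr ⟨Additive.toMul x, rfl⟩))

/-- **`0 → Eˣ → J_E → C_E → 0` is short exact in `Rep ℤ Gal(E/F)`**: `Eˣ → J_E` is injective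
(`IdeleHerbrand.principal_injective`), `J_E → C_E` is surjective, and its kernel is the group of principal idèles.
The long exact cohomology sequence of this sequence (Mathlib `groupCohomology.δ`), with Hilbert 90 and
`isZero_H1_galoisRep`, is the frame of Tate's construction of the fundamental class (VII §11).
[cite: CasselsFrohlichANT1967, Ch. VII §8 (and §11.2)] -/
theorem ideleClassShortComplex_shortExact : (ideleClassShortComplex F E).ShortExact := by
  refine shortExact_of_apply (ideleClassShortComplex F E) (fun a b h => ?_) (fun c => ?_) (fun x hx => ?_)
  · -- `Eˣ → J_E` is injective
    exact Additive.toMul.injective (IdeleHerbrand.principal_injective (Additive.ofMul.injective h))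
  · -- `J_E → C_E` is onto
    obtain ⟨y, hy⟩ := QuotientGroup.mk_surjective (Additive.toMul (α := IdeleClassGroup E) c)
    exact ⟨Additive.ofMul y, (congrArg Additive.ofMul hy).trans rfl⟩
  · -- `[x] = 1`, so `x` is principal
    have hx' : ((Additive.toMul x : ideleGroup E) : IdeleClassGroup E) = 1 := congrArg Additive.toMul hx
    obtain ⟨k, hk⟩ := (QuotientGroup.eq_one_iff _).mp hx'
    exact ⟨Additive.ofMul k, congrArg Additive.ofMul hk⟩

/-- `X₁ = Eˣ`, `X₂ = J_E`, `X₃ = C_E` (definitional unfoldings of the short complex). [cite: CasselsFrohlichANT1967, Ch. VII §8] -/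
theorem ideleClassShortComplex_X₃ : (ideleClassShortComplex F E).X₃ = galoisRep F E := rfl

/-- **The relative Brauer group embeds into the idèle cohomology: `H²(Gal(E/F), Eˣ) → H²(Gal(E/F), J_E)` is
injective** — the piece `H¹(G, C_E) = 0 ⟹ H²(G, Eˣ) ↪ H²(G, J_E)` of the long exact sequence of
`0 → Eˣ → J_E → C_E → 0` (Tate, Cassels–Fröhlich VII §9, consequence of Thm. 9.1 (2); with the local decomposition of
`H²(G, J_E)` this is the Hasse principle for central simple algebras split by `E`).
[cite: CasselsFrohlichANT1967, Ch. VII §9 Thm. 9.1 (consequences)] -/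
theorem mono_H2_map_principalRepHom [NumberField F] [IsGalois F E] :
    Mono (groupCohomology.mapShortComplex₁ (ideleClassShortComplex_shortExact F E) (i := 1) (j := 2) rfl).g := by
  have hex := groupCohomology.mapShortComplex₁_exact (ideleClassShortComplex_shortExact F E) (i := 1) (j := 2) rfl
  refine hex.mono_g (IsZero.eq_of_src ?_ _ _)
  exact isZero_H1_galoisRep (F := F) (E := E)

omit [NumberField E] in
/-- **Hilbert 90 in `IsZero` form**: `H¹(Gal(E/F), Eˣ) = 0` (Mathlib `groupCohomology.H1ofAutOnUnitsUnique`).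
[cite: SerreLocalFields1979, Ch. X §1 Prop. 2] -/
theorem isZero_H1_unitsRep [FiniteDimensional F E] :
    IsZero (groupCohomology (Rep.ofAlgebraAutOnUnits F E) 1) :=
  @ModuleCat.isZero_of_subsingleton _ _ _ (inferInstance : Subsingleton (H1 (Rep.ofAlgebraAutOnUnits F E)))

/-- **`H⁰(G, J_E) → H⁰(G, C_E)` is onto: every `Gal(E/F)`-fixed idèle class is the class of a fixed idèle, i.e.
of an idèle of `F`** (`C_E^G = C_F`, Tate VII §8 Prop. 8.1 / Neukirch III (2.7)) — here as the piece
`H⁰(J_E) → H⁰(C_E) → H¹(Eˣ) = 0` of the long exact sequence of `0 → Eˣ → J_E → C_E → 0` (Hilbert 90), the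
`groupCohomology` counterpart of the element-form descent `exists_classBaseChange_eq_of_forall_classGalAct_eq`.
[cite: CasselsFrohlichANT1967, Ch. VII §8 Prop. 8.1] -/
theorem epi_H0_map_classRepHom [NumberField F] [IsGalois F E] :
    Epi (groupCohomology.mapShortComplex₃ (ideleClassShortComplex_shortExact F E) (i := 0) (j := 1) rfl).f := by
  have hex := groupCohomology.mapShortComplex₃_exact (ideleClassShortComplex_shortExact F E) (i := 0) (j := 1) rfl
  refine hex.epi_f (IsZero.eq_of_tgt ?_ _ _)
  exact isZero_H1_unitsRep F E

end IdeleClassGroup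

end Literature.NumberTheory.Automorphic

end
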